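import Mathlib
import Summits.MatrixMultiplication.MatrixMultiplication.Theorems.SubgroupIdentityDesigns.Negative.NormOneTorus
import Summits.MatrixMultiplication.MatrixMultiplication.Theorems.SubgroupIdentityDesigns.Negative.SingerConj

/-!
# The split-torus certificate: `O₂⁺(𝔽_p)` plus one non-unimodular toral element (all `p`)

Route `LevelGradedCohnUmans`, crux `SubgroupIdentityDesigns`, the `(m,k) = (2,1)` cell, `p`-free
case.  `NormOneTorus` kills the level-`1` identity design when a member contains the ANISOTROPIC
dihedral group `O₂⁻(𝔽_p)`; its split counterpart `O₂⁺(𝔽_p) = {diag(t,t⁻¹)} ⋊ ⟨w⟩`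
(`w`-coset `= {[[0,t⁻¹],[t,0]]}`) carries NO single-member certificate (it has a regular orbit, so
every irreducible character occurs in its permutation character).  The new mechanism is a WEIGHTED
(signed, two-coset) certificate: with `D_t = diag(t,t⁻¹)`, `R_t = [[0,t⁻¹],[t,0]]` and a twist
`d ∈ 𝔽_p^× ∖ {1}`, `D^d_t = diag(t, d t⁻¹)`, `R^d_t = [[0, d t⁻¹],[t,0]]`, every level-`1`
function `F = Σ_{rk M ≤ 1} c_M ψ(tr(M·))` satisfies
`Σ_t F(D_t) - Σ_t F(R_t) - Σ_t F(D^d_t) + Σ_t F(R^d_t) = 0` (`sum_units_fourier_splitMonomial`):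
on a rank-one `M = a bᵀ` the four families of vectors `X a` cancel in pairs — `D ↔ R`,
`D^d ↔ R^d` for `a` off the coordinate axes, `D ↔ D^d`, `R ↔ R^d` for `a` on an axis
(`splitMonomial_pushforward`).  Reading the identity against the design (`F(1) = 1`, `F = 0` on
the other listed elements when they are triple products) gives `1 = 0`.

This file: the identity, the abstract placement theorem `no_levelOne_design_of_splitMonomial`
(all `p`, no TPP, no volume hypothesis: if every `D_t ≠ 1`, `R_t`, `D^d_t`, `R^d_t` is a triple
product `a b g`, there is no level-`1` identity design), and the factorisations `x = g₀ y`,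
`x = y g₀` of the twisted elements through a diagonal `g₀` with `g₀₀₀g₀₁₁ = d`
(`splitMonomial_left/right_diag/antidiag`) used by the member placements in
`SplitMonomialPlacements` (a member containing `O₂⁺(𝔽_p)` and a diagonal `g₀` with
`g₀₀₀ g₀₁₁ ≠ 1` — e.g. the monomial group `N(T)`, or `K_Δ = {diag(t₁,t₂), [[0,t₂],[t₁,0]] :
t₁t₂ ∈ Δ}`, `1 ≠ Δ ≤ 𝔽_p^×` — in the same or in another member).  At `p = 5` this settles the
`p`-free member class `Z·2.S₄ ⊇ N(T)` left open in `WitnessStatus`.  VALUE = THEOREM, NOT summit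
progress; the crux item stmt-MatrixMultiplication-14079 is untouched and remains open.
-/

set_option linter.dupNamespace false

noncomputable section

open scoped BigOperators Classical

open Summit.MatrixMultiplication.MatrixMultiplication.Theorems.LieRankDesigns.Negative (GLm Mat)

namespace Summit.MatrixMultiplication.MatrixMultiplication.Theorems.SubgroupIdentityDesigns.Negative

section SplitMonomial

variable {p : ℕ} [hp : Fact p.Prime]

/-- `2 × 2` matrix literal times a vector. -/
theorem mulVec_of_fin_two (α β γ δ : ZMod p) (a : Fin 2 → ZMod p) :
    (!![α, β; γ, δ] : Mat p 2).mulVec a = ![α * a 0 + β * a 1, γ * a 0 + δ * a 1] := by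
  funext i
  fin_cases i <;> simp [Matrix.mulVec, dotProduct, Fin.sum_univ_two]

/-- **The pushforward identity.**  For `a ≠ 0`, `d ≠ 0` and any function `φ` of a vector
(written as a function of the two coordinates), the four families `D_t a`, `R_t a`, `D^d_t a`,
`R^d_t a` (`t ∈ 𝔽_p^×`) cancel: `Σ φ(D a) - Σ φ(R a) - Σ φ(D^d a) + Σ φ(R^d a) = 0`. -/
theorem splitMonomial_pushforward (φ : ZMod p → ZMod p → ℂ) {d : ZMod p} (hd : d ≠ 0)
    (a : Fin 2 → ZMod p) (ha : a ≠ 0) :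
    (∑ t : (ZMod p)ˣ, φ ((t : ZMod p) * a 0) ((t : ZMod p)⁻¹ * a 1)) -
      (∑ t : (ZMod p)ˣ, φ ((t : ZMod p)⁻¹ * a 1) ((t : ZMod p) * a 0)) -
      (∑ t : (ZMod p)ˣ, φ ((t : ZMod p) * a 0) (d * (t : ZMod p)⁻¹ * a 1)) +
      (∑ t : (ZMod p)ˣ, φ (d * (t : ZMod p)⁻¹ * a 1) ((t : ZMod p) * a 0)) = 0 := by
  set du : (ZMod p)ˣ := Units.mk0 d hd with hdu
  have hduv : (du : ZMod p) = d := Units.val_mk0 hd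
  by_cases h0 : a 0 = 0
  · -- `a` on the second axis: `D ↔ D^d`, `R ↔ R^d` by `t ↦ t d`
    have h1 : a 1 ≠ 0 := fun h1 => ha (by funext i; fin_cases i <;> assumption)
    have e13 : (∑ t : (ZMod p)ˣ, φ ((t : ZMod p) * a 0) ((t : ZMod p)⁻¹ * a 1)) =
        ∑ t : (ZMod p)ˣ, φ ((t : ZMod p) * a 0) (d * (t : ZMod p)⁻¹ * a 1) := by
      refine Fintype.sum_equiv (Equiv.mulRight du) _ _ fun t => ?_
      simp only [Equiv.coe_mulRight, Units.val_mul, hduv, h0, mul_zero]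
      congr 1
      field_simp
    have e24 : (∑ t : (ZMod p)ˣ, φ ((t : ZMod p)⁻¹ * a 1) ((t : ZMod p) * a 0)) =
        ∑ t : (ZMod p)ˣ, φ (d * (t : ZMod p)⁻¹ * a 1) ((t : ZMod p) * a 0) := by
      refine Fintype.sum_equiv (Equiv.mulRight du) _ _ fun t => ?_
      simp only [Equiv.coe_mulRight, Units.val_mul, hduv, h0, mul_zero]
      congr 1
      field_simp
    rw [e13, e24]; ring
  by_cases h1 : a 1 = 0
  · -- `a` on the first axis: the twist is invisible
    simp only [h1, mul_zero]
    ring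
  · -- `a` off the axes: `D ↔ R` by `t ↦ (a₁/a₀) t⁻¹`, `D^d ↔ R^d` by `t ↦ d (a₁/a₀) t⁻¹`
    set cu : (ZMod p)ˣ := Units.mk0 (a 1 / a 0) (div_ne_zero h1 h0) with hcu
    have hcuv : (cu : ZMod p) = a 1 / a 0 := Units.val_mk0 _
    have e12 : (∑ t : (ZMod p)ˣ, φ ((t : ZMod p) * a 0) ((t : ZMod p)⁻¹ * a 1)) =
        ∑ t : (ZMod p)ˣ, φ ((t : ZMod p)⁻¹ * a 1) ((t : ZMod p) * a 0) := by
      refine Fintype.sum_equiv ((Equiv.inv (ZMod p)ˣ).trans (Equiv.mulLeft cu)) _ _ fun t => ?_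
      simp only [Equiv.trans_apply, Equiv.inv_apply, Equiv.coe_mulLeft, Units.val_mul,
        Units.val_inv_eq_inv_val, hcuv]
      congr 1
      · field_simp
      · field_simp
    have e34 : (∑ t : (ZMod p)ˣ, φ ((t : ZMod p) * a 0) (d * (t : ZMod p)⁻¹ * a 1)) =
        ∑ t : (ZMod p)ˣ, φ (d * (t : ZMod p)⁻¹ * a 1) ((t : ZMod p) * a 0) := by
      refine Fintype.sum_equiv ((Equiv.inv (ZMod p)ˣ).trans (Equiv.mulLeft (du * cu))) _ _
        fun t => ?_
      simp only [Equiv.trans_apply, Equiv.inv_apply, Equiv.coe_mulLeft, Units.val_mul,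
        Units.val_inv_eq_inv_val, hcuv, hduv]
      congr 1
      · field_simp
      · field_simp
    rw [e12, e34]; ring

/-- **The split-monomial Fourier identity.**  For a level-`1` coefficient table `c`
(`c_M = 0` when `rk M > 1`) and `d ≠ 0`, with `F(X) = Σ_M c_M ψ(tr(M X))`:
`Σ_t F(D_t) - Σ_t F(R_t) - Σ_t F(D^d_t) + Σ_t F(R^d_t) = 0`. -/
theorem sum_units_fourier_splitMonomial (c : Mat p 2 → ℂ)
    (hc : ∀ M : Mat p 2, 1 < M.rank → c M = 0) {d : ZMod p} (hd : d ≠ 0) :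
    (∑ t : (ZMod p)ˣ, ∑ M : Mat p 2, c M * ZMod.stdAddChar
        (Matrix.trace (M * !![(t : ZMod p), 0; 0, (t : ZMod p)⁻¹]))) -
      (∑ t : (ZMod p)ˣ, ∑ M : Mat p 2, c M * ZMod.stdAddChar
        (Matrix.trace (M * !![0, (t : ZMod p)⁻¹; (t : ZMod p), 0]))) -
      (∑ t : (ZMod p)ˣ, ∑ M : Mat p 2, c M * ZMod.stdAddChar
        (Matrix.trace (M * !![(t : ZMod p), 0; 0, d * (t : ZMod p)⁻¹]))) +
      (∑ t : (ZMod p)ˣ, ∑ M : Mat p 2, c M * ZMod.stdAddChar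
        (Matrix.trace (M * !![0, d * (t : ZMod p)⁻¹; (t : ZMod p), 0]))) = 0 := by
  -- bring `Σ_M c_M` outside
  have swap : ∀ X : (ZMod p)ˣ → Mat p 2,
      (∑ t : (ZMod p)ˣ, ∑ M : Mat p 2, c M * ZMod.stdAddChar (Matrix.trace (M * X t))) =
        ∑ M : Mat p 2, c M * ∑ t : (ZMod p)ˣ, ZMod.stdAddChar (Matrix.trace (M * X t)) := by
    intro X
    rw [Finset.sum_comm]
    exact Finset.sum_congr rfl fun M _ => by rw [Finset.mul_sum]
  rw [swap (fun t => !![(t : ZMod p), 0; 0, (t : ZMod p)⁻¹]),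
    swap (fun t => !![0, (t : ZMod p)⁻¹; (t : ZMod p), 0]),
    swap (fun t => !![(t : ZMod p), 0; 0, d * (t : ZMod p)⁻¹]),
    swap (fun t => !![0, d * (t : ZMod p)⁻¹; (t : ZMod p), 0]),
    ← Finset.sum_sub_distrib, ← Finset.sum_sub_distrib, ← Finset.sum_add_distrib]
  refine Finset.sum_eq_zero fun M _ => ?_
  rw [← mul_sub, ← mul_sub, ← mul_add]
  by_cases hcM : c M = 0
  · rw [hcM, zero_mul]
  have hM : M.rank ≤ 1 := by
    by_contra h
    exact hcM (hc M (by omega))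
  by_cases hM0 : M = 0
  · subst hM0
    simp only [Matrix.zero_mul, Matrix.trace_zero, sub_self, zero_sub, neg_add_cancel, mul_zero]
  obtain ⟨a, b, ha, rfl⟩ := exists_vecMulVec_of_rank_le_one M hM hM0
  simp_rw [trace_vecMulVec_mul]
  simp only [mulVec_of_fin_two, zero_mul, add_zero, zero_add]
  rw [splitMonomial_pushforward (fun x y => (ZMod.stdAddChar (b ⬝ᵥ ![x, y]) : ℂ)) hd a ha,
    mul_zero]

/-- **NO LEVEL-ONE IDENTITY DESIGN FROM A SPLIT-MONOMIAL CERTIFICATE** (abstract placement).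
If, for some `d ∉ {0,1}`, every `D_t ≠ 1`, every `R_t`, every `D^d_t` and every `R^d_t`
(`t ∈ 𝔽_p^×`; as elements of `GL₂(𝔽_p)`: diagonal with `x₀₀x₁₁ ∈ {1,d}`, anti-diagonal with
`x₀₁x₁₀ ∈ {1,d}`) is a triple product `a b g` (`a ∈ H₁, b ∈ H₂, g ∈ H₃`), then `(H₁,H₂,H₃)` carries
no level-`1` identity design.  All `p`; no TPP. -/
theorem no_levelOne_design_of_splitMonomial {H₁ H₂ H₃ : Subgroup (GLm p 2)} {d : ZMod p}
    (hd0 : d ≠ 0) (hd1 : d ≠ 1)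
    (hPD : ∀ x : GLm p 2, (x : Mat p 2) 0 1 = 0 → (x : Mat p 2) 1 0 = 0 →
      (x : Mat p 2) 0 0 * (x : Mat p 2) 1 1 = 1 → x ≠ 1 →
      ∃ a ∈ H₁, ∃ b ∈ H₂, ∃ g ∈ H₃, a * b * g = x)
    (hPR : ∀ x : GLm p 2, (x : Mat p 2) 0 0 = 0 → (x : Mat p 2) 1 1 = 0 →
      (x : Mat p 2) 0 1 * (x : Mat p 2) 1 0 = 1 →
      ∃ a ∈ H₁, ∃ b ∈ H₂, ∃ g ∈ H₃, a * b * g = x)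
    (hPDd : ∀ x : GLm p 2, (x : Mat p 2) 0 1 = 0 → (x : Mat p 2) 1 0 = 0 →
      (x : Mat p 2) 0 0 * (x : Mat p 2) 1 1 = d →
      ∃ a ∈ H₁, ∃ b ∈ H₂, ∃ g ∈ H₃, a * b * g = x)
    (hPRd : ∀ x : GLm p 2, (x : Mat p 2) 0 0 = 0 → (x : Mat p 2) 1 1 = 0 →
      (x : Mat p 2) 0 1 * (x : Mat p 2) 1 0 = d →
      ∃ a ∈ H₁, ∃ b ∈ H₂, ∃ g ∈ H₃, a * b * g = x) :
    ¬ ∃ c : Mat p 2 → ℂ, (∀ M, 1 < M.rank → c M = 0) ∧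
      (∑ M, c M * ZMod.stdAddChar (Matrix.trace (M * ((1 : GLm p 2) : Mat p 2)))) = 1 ∧
      ∀ a ∈ H₁, ∀ b ∈ H₂, ∀ g ∈ H₃, a * b * g ≠ 1 →
        (∑ M, c M *
          ZMod.stdAddChar (Matrix.trace (M * ((a * b * g : GLm p 2) : Mat p 2)))) = 0 := by
  rintro ⟨c, hc, hc1, hc0⟩
  set F : Mat p 2 → ℂ := fun X => ∑ M : Mat p 2, c M * ZMod.stdAddChar (Matrix.trace (M * X))
    with hF
  have hF0 : ∀ x : GLm p 2, (∃ a ∈ H₁, ∃ b ∈ H₂, ∃ g ∈ H₃, a * b * g = x) → x ≠ 1 →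
      F (x : Mat p 2) = 0 := by
    rintro x ⟨a, ha, b, hb, g, hg, rfl⟩ hx
    exact hc0 a ha b hb g hg hx
  have hF1 : F 1 = 1 := by
    have := hc1; rwa [Units.val_one] at this
  -- the identity element is recognised by its `(0,0)` entry / its shape
  have ne_one_of₀₀ : ∀ x : GLm p 2, (x : Mat p 2) 0 0 ≠ 1 → x ≠ 1 := by
    rintro x hx rfl
    exact hx (by rw [Units.val_one, Matrix.one_apply_eq])
  have ne_one_of_prod : ∀ x : GLm p 2, (x : Mat p 2) 0 0 * (x : Mat p 2) 1 1 = d → x ≠ 1 := by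
    rintro x hx rfl
    rw [Units.val_one, Matrix.one_apply_eq, Matrix.one_apply_eq, mul_one] at hx
    exact hd1 hx.symm
  -- values of `F` on the four families
  have vD : ∀ t : (ZMod p)ˣ, F !![(t : ZMod p), 0; 0, (t : ZMod p)⁻¹] = if t = 1 then 1 else 0 := by
    intro t
    split_ifs with ht
    · subst ht
      rw [← hF1]
      congr 1
      rw [Units.val_one, inv_one, Matrix.one_fin_two]
    · obtain ⟨x, x00, x01, x10, x11⟩ := exists_gl2 (t : ZMod p) 0 0 (t : ZMod p)⁻¹
        (by rw [mul_inv_cancel₀ t.ne_zero, zero_mul, sub_zero]; exact one_ne_zero)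
      have hx : (x : Mat p 2) = !![(t : ZMod p), 0; 0, (t : ZMod p)⁻¹] := by
        rw [Matrix.eta_fin_two (x : Mat p 2), x00, x01, x10, x11]
      have hx1 : x ≠ 1 := ne_one_of₀₀ x (by rw [x00]; exact fun h => ht (Units.ext h))
      rw [← hx]
      exact hF0 x (hPD x x01 x10 (by rw [x00, x11, mul_inv_cancel₀ t.ne_zero]) hx1) hx1
  have vR : ∀ t : (ZMod p)ˣ, F !![0, (t : ZMod p)⁻¹; (t : ZMod p), 0] = 0 := by
    intro t
    obtain ⟨x, x00, x01, x10, x11⟩ := exists_gl2 0 (t : ZMod p)⁻¹ (t : ZMod p) 0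
      (by rw [zero_mul, inv_mul_cancel₀ t.ne_zero, zero_sub]; exact neg_ne_zero.mpr one_ne_zero)
    have hx : (x : Mat p 2) = !![0, (t : ZMod p)⁻¹; (t : ZMod p), 0] := by
      rw [Matrix.eta_fin_two (x : Mat p 2), x00, x01, x10, x11]
    have hx1 : x ≠ 1 := ne_one_of₀₀ x (by rw [x00]; exact zero_ne_one)
    rw [← hx]
    exact hF0 x (hPR x x00 x11 (by rw [x01, x10, inv_mul_cancel₀ t.ne_zero])) hx1
  have vDd : ∀ t : (ZMod p)ˣ, F !![(t : ZMod p), 0; 0, d * (t : ZMod p)⁻¹] = 0 := by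
    intro t
    obtain ⟨x, x00, x01, x10, x11⟩ := exists_gl2 (t : ZMod p) 0 0 (d * (t : ZMod p)⁻¹)
      (by rw [zero_mul, sub_zero, mul_left_comm, mul_inv_cancel₀ t.ne_zero, mul_one]; exact hd0)
    have hx : (x : Mat p 2) = !![(t : ZMod p), 0; 0, d * (t : ZMod p)⁻¹] := by
      rw [Matrix.eta_fin_two (x : Mat p 2), x00, x01, x10, x11]
    have hprod : (x : Mat p 2) 0 0 * (x : Mat p 2) 1 1 = d := by
      rw [x00, x11, mul_left_comm, mul_inv_cancel₀ t.ne_zero, mul_one]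
    rw [← hx]
    exact hF0 x (hPDd x x01 x10 hprod) (ne_one_of_prod x hprod)
  have vRd : ∀ t : (ZMod p)ˣ, F !![0, d * (t : ZMod p)⁻¹; (t : ZMod p), 0] = 0 := by
    intro t
    obtain ⟨x, x00, x01, x10, x11⟩ := exists_gl2 0 (d * (t : ZMod p)⁻¹) (t : ZMod p) 0
      (by rw [zero_mul, zero_sub, mul_assoc, inv_mul_cancel₀ t.ne_zero, mul_one]
          exact neg_ne_zero.mpr hd0)
    have hx : (x : Mat p 2) = !![0, d * (t : ZMod p)⁻¹; (t : ZMod p), 0] := by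
      rw [Matrix.eta_fin_two (x : Mat p 2), x00, x01, x10, x11]
    have hx1 : x ≠ 1 := ne_one_of₀₀ x (by rw [x00]; exact zero_ne_one)
    rw [← hx]
    exact hF0 x (hPRd x x00 x11 (by rw [x01, x10, mul_assoc, inv_mul_cancel₀ t.ne_zero, mul_one]))
      hx1
  -- read the Fourier identity against these values: `1 - 0 - 0 + 0 = 0`
  have key := sum_units_fourier_splitMonomial c hc hd0
  have e1 : (∑ t : (ZMod p)ˣ, F !![(t : ZMod p), 0; 0, (t : ZMod p)⁻¹]) = 1 := by
    simp_rw [vD]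
    rw [Finset.sum_ite_eq' Finset.univ (1 : (ZMod p)ˣ) (fun _ => (1 : ℂ))]
    simp
  have e2 : (∑ t : (ZMod p)ˣ, F !![0, (t : ZMod p)⁻¹; (t : ZMod p), 0]) = 0 :=
    Finset.sum_eq_zero fun t _ => vR t
  have e3 : (∑ t : (ZMod p)ˣ, F !![(t : ZMod p), 0; 0, d * (t : ZMod p)⁻¹]) = 0 :=
    Finset.sum_eq_zero fun t _ => vDd t
  have e4 : (∑ t : (ZMod p)ˣ, F !![0, d * (t : ZMod p)⁻¹; (t : ZMod p), 0]) = 0 :=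
    Finset.sum_eq_zero fun t _ => vRd t
  have key' : (∑ t : (ZMod p)ˣ, F !![(t : ZMod p), 0; 0, (t : ZMod p)⁻¹]) -
      (∑ t : (ZMod p)ˣ, F !![0, (t : ZMod p)⁻¹; (t : ZMod p), 0]) -
      (∑ t : (ZMod p)ˣ, F !![(t : ZMod p), 0; 0, d * (t : ZMod p)⁻¹]) +
      (∑ t : (ZMod p)ˣ, F !![0, d * (t : ZMod p)⁻¹; (t : ZMod p), 0]) = 0 := key
  rw [e1, e2, e3, e4] at key'
  norm_num at key'


/-! ### Factorisations through a diagonal element `g₀` -/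

/-- Left factorisation of a diagonal `x` with `x₀₀x₁₁ = g₀₀₀g₀₁₁`: `x = g₀ y`, `y ∈ SO₂⁺ ⊆ H`. -/
theorem splitMonomial_left_diag {H : Subgroup (GLm p 2)}
    (hD : ∀ y : GLm p 2, (y : Mat p 2) 0 1 = 0 → (y : Mat p 2) 1 0 = 0 →
      (y : Mat p 2) 0 0 * (y : Mat p 2) 1 1 = 1 → y ∈ H)
    (g₀ : GLm p 2) (h01 : (g₀ : Mat p 2) 0 1 = 0) (h10 : (g₀ : Mat p 2) 1 0 = 0)
    (x : GLm p 2) (x01 : (x : Mat p 2) 0 1 = 0) (x10 : (x : Mat p 2) 1 0 = 0)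
    (hx : (x : Mat p 2) 0 0 * (x : Mat p 2) 1 1 = (g₀ : Mat p 2) 0 0 * (g₀ : Mat p 2) 1 1) :
    ∃ y ∈ H, g₀ * y = x := by
  obtain ⟨h00, h11⟩ := lower_diag_ne_zero g₀ h01
  obtain ⟨y, y00, y01, y10, y11⟩ := exists_gl2 ((x : Mat p 2) 0 0 / (g₀ : Mat p 2) 0 0) 0 0
    ((x : Mat p 2) 1 1 / (g₀ : Mat p 2) 1 1) (by
      rw [zero_mul, sub_zero, div_mul_div_comm, hx, div_self (mul_ne_zero h00 h11)]
      exact one_ne_zero)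
  refine ⟨y, hD y y01 y10 (by rw [y00, y11, div_mul_div_comm, hx, div_self (mul_ne_zero h00 h11)]),
    gl2_ext ?_ ?_ ?_ ?_⟩
  · rw [gl2_mul_apply, y00, h01, zero_mul, add_zero, mul_div_cancel₀ _ h00]
  · rw [gl2_mul_apply, y01, h01, mul_zero, zero_mul, add_zero, x01]
  · rw [gl2_mul_apply, h10, y10, zero_mul, mul_zero, add_zero, x10]
  · rw [gl2_mul_apply, h10, y11, zero_mul, zero_add, mul_div_cancel₀ _ h11]

/-- Right factorisation of a diagonal `x` with `x₀₀x₁₁ = g₀₀₀g₀₁₁`: `x = y g₀`, `y ∈ SO₂⁺ ⊆ H`. -/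
theorem splitMonomial_right_diag {H : Subgroup (GLm p 2)}
    (hD : ∀ y : GLm p 2, (y : Mat p 2) 0 1 = 0 → (y : Mat p 2) 1 0 = 0 →
      (y : Mat p 2) 0 0 * (y : Mat p 2) 1 1 = 1 → y ∈ H)
    (g₀ : GLm p 2) (h01 : (g₀ : Mat p 2) 0 1 = 0) (h10 : (g₀ : Mat p 2) 1 0 = 0)
    (x : GLm p 2) (x01 : (x : Mat p 2) 0 1 = 0) (x10 : (x : Mat p 2) 1 0 = 0)
    (hx : (x : Mat p 2) 0 0 * (x : Mat p 2) 1 1 = (g₀ : Mat p 2) 0 0 * (g₀ : Mat p 2) 1 1) :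
    ∃ y ∈ H, y * g₀ = x := by
  obtain ⟨h00, h11⟩ := lower_diag_ne_zero g₀ h01
  obtain ⟨y, y00, y01, y10, y11⟩ := exists_gl2 ((x : Mat p 2) 0 0 / (g₀ : Mat p 2) 0 0) 0 0
    ((x : Mat p 2) 1 1 / (g₀ : Mat p 2) 1 1) (by
      rw [zero_mul, sub_zero, div_mul_div_comm, hx, div_self (mul_ne_zero h00 h11)]
      exact one_ne_zero)
  refine ⟨y, hD y y01 y10 (by rw [y00, y11, div_mul_div_comm, hx, div_self (mul_ne_zero h00 h11)]),
    gl2_ext ?_ ?_ ?_ ?_⟩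
  · rw [gl2_mul_apply, y00, y01, zero_mul, add_zero, div_mul_cancel₀ _ h00]
  · rw [gl2_mul_apply, y01, h01, mul_zero, zero_mul, add_zero, x01]
  · rw [gl2_mul_apply, h10, y10, zero_mul, mul_zero, add_zero, x10]
  · rw [gl2_mul_apply, y10, y11, zero_mul, zero_add, div_mul_cancel₀ _ h11]

/-- Left factorisation of an anti-diagonal `x` with `x₀₁x₁₀ = g₀₀₀g₀₁₁`: `x = g₀ y`, `y` a
reflection of `O₂⁺` (`y₀₁y₁₀ = 1`). -/
theorem splitMonomial_left_antidiag {H : Subgroup (GLm p 2)}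
    (hR : ∀ y : GLm p 2, (y : Mat p 2) 0 0 = 0 → (y : Mat p 2) 1 1 = 0 →
      (y : Mat p 2) 0 1 * (y : Mat p 2) 1 0 = 1 → y ∈ H)
    (g₀ : GLm p 2) (h01 : (g₀ : Mat p 2) 0 1 = 0) (h10 : (g₀ : Mat p 2) 1 0 = 0)
    (x : GLm p 2) (x00 : (x : Mat p 2) 0 0 = 0) (x11 : (x : Mat p 2) 1 1 = 0)
    (hx : (x : Mat p 2) 0 1 * (x : Mat p 2) 1 0 = (g₀ : Mat p 2) 0 0 * (g₀ : Mat p 2) 1 1) :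
    ∃ y ∈ H, g₀ * y = x := by
  obtain ⟨h00, h11⟩ := lower_diag_ne_zero g₀ h01
  obtain ⟨y, y00, y01, y10, y11⟩ := exists_gl2 0 ((x : Mat p 2) 0 1 / (g₀ : Mat p 2) 0 0)
    ((x : Mat p 2) 1 0 / (g₀ : Mat p 2) 1 1) 0 (by
      rw [zero_mul, zero_sub, div_mul_div_comm, hx, div_self (mul_ne_zero h00 h11)]
      exact neg_ne_zero.mpr one_ne_zero)
  refine ⟨y, hR y y00 y11 (by rw [y01, y10, div_mul_div_comm, hx, div_self (mul_ne_zero h00 h11)]),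
    gl2_ext ?_ ?_ ?_ ?_⟩
  · rw [gl2_mul_apply, y00, h01, mul_zero, zero_mul, add_zero, x00]
  · rw [gl2_mul_apply, y01, h01, zero_mul, add_zero, mul_div_cancel₀ _ h00]
  · rw [gl2_mul_apply, h10, y10, zero_mul, zero_add, mul_div_cancel₀ _ h11]
  · rw [gl2_mul_apply, h10, y11, zero_mul, mul_zero, add_zero, x11]

/-- Right factorisation of an anti-diagonal `x` with `x₀₁x₁₀ = g₀₀₀g₀₁₁`: `x = y g₀`. -/
theorem splitMonomial_right_antidiag {H : Subgroup (GLm p 2)}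
    (hR : ∀ y : GLm p 2, (y : Mat p 2) 0 0 = 0 → (y : Mat p 2) 1 1 = 0 →
      (y : Mat p 2) 0 1 * (y : Mat p 2) 1 0 = 1 → y ∈ H)
    (g₀ : GLm p 2) (h01 : (g₀ : Mat p 2) 0 1 = 0) (h10 : (g₀ : Mat p 2) 1 0 = 0)
    (x : GLm p 2) (x00 : (x : Mat p 2) 0 0 = 0) (x11 : (x : Mat p 2) 1 1 = 0)
    (hx : (x : Mat p 2) 0 1 * (x : Mat p 2) 1 0 = (g₀ : Mat p 2) 0 0 * (g₀ : Mat p 2) 1 1) :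
    ∃ y ∈ H, y * g₀ = x := by
  obtain ⟨h00, h11⟩ := lower_diag_ne_zero g₀ h01
  obtain ⟨y, y00, y01, y10, y11⟩ := exists_gl2 0 ((x : Mat p 2) 0 1 / (g₀ : Mat p 2) 1 1)
    ((x : Mat p 2) 1 0 / (g₀ : Mat p 2) 0 0) 0 (by
      rw [zero_mul, zero_sub, div_mul_div_comm, mul_comm ((g₀ : Mat p 2) 1 1), hx,
        div_self (mul_ne_zero h00 h11)]
      exact neg_ne_zero.mpr one_ne_zero)
  refine ⟨y, hR y y00 y11 (by
      rw [y01, y10, div_mul_div_comm, mul_comm ((g₀ : Mat p 2) 1 1), hx,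
        div_self (mul_ne_zero h00 h11)]),
    gl2_ext ?_ ?_ ?_ ?_⟩
  · rw [gl2_mul_apply, y00, h10, zero_mul, mul_zero, add_zero, x00]
  · rw [gl2_mul_apply, y00, y01, zero_mul, zero_add, div_mul_cancel₀ _ h11]
  · rw [gl2_mul_apply, y10, y11, zero_mul, add_zero, div_mul_cancel₀ _ h00]
  · rw [gl2_mul_apply, y10, h01, y11, mul_zero, zero_mul, add_zero, x11]

end SplitMonomial

end Summit.MatrixMultiplication.MatrixMultiplication.Theorems.SubgroupIdentityDesigns.Negative

end
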